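import Summits.BirchSwinnertonDyer.BirchSwinnertonDyer.Theorems.PrintCf2SplitBadTwoLocalGroupsBridge
import Summits.BirchSwinnertonDyer.Rank1Residual.X11b.LocalTrivialityBridge
import Literature.NumberTheory.GaloisRepresentations.UnramifiedClassesInertia
import Literature.NumberTheory.GaloisCohomology.KolyvaginSystems
import HarnessLib

/-!
# Crux `PrintCf2.SplitBadTwoRankOneOfFacts` (stmt-BirchSwinnertonDyer-20368), S3n′-FACT-FREE road (a), H¹-transport FILE 2:
# `H¹(Gal(K̄/L), M) ≅ H¹(Γ_L, M|_{res})` WITH THE LOCAL CONDITIONS MATCHED — the line's `subgroupH1 / conjH1 / decompIn / inertiaIn` currency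
# versus the layer field's own `galoisCohomology / localization / unramifiedSubgroup` currency

Cell `bsd-print-cf2`, WIDTH seat `bsd-line-cf2-p1-w6` g6 (prover-bsd-line-cf2-p1-w6-g6-0); `--supports stmt-BirchSwinnertonDyer-20368` (helper,
Theses-free). HONEST FRAMING: cohomological bookkeeping; nothing here closes the crux or a registered stub; BSD is not proved by any of this;
no summit statement is proved by this seat. No definition, no named fact, no instance, no `sorry`.

SETTING. `K` a number field; `L ⊆ K̄` a finite subextension (`[NumberField L]`), `res = absGaloisRestrict K L : Γ_L → Γ_K` (injective) and `U ⊴ Γ_K`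
with `res(Γ_L) = U` (hypothesis `hU`; `= galFixing K L` for `L/K` normal — `LocalGroupsBridge.range_absGaloisRestrict_eq_galFixing`); `M` a discrete
`Γ_K`-module with open stabilisers (`hM`), `ρL := (LocBridge.ofSMul M hM).restrictField L : DiscreteGaloisModule L M` (Γ_L acting through `res`).
For a finite place `w` of `K`, `σ ∈ Γ_K` and a place `w'` of `L` «cut out by `σ`» in the sense of FILE 1 (`LayerFieldPlaces`, (P1)):
`U ⊓ σ⁻¹·D_w·σ = res(D_{w'}(L))` (`hD`) and `U ⊓ σ⁻¹·I_w·σ = res(I_{w'}(L))` (`hI`).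

* §0 generic: pull-back of `H¹` along a continuous homomorphism ONTO a group is injective (`map_one_injective_of_surjective`); along a
  homomorphism with a continuous two-sided inverse, surjective (`map_one_surjective_of_inverse`) — cocycle level (`ContinuousH1`).
* §1 **`exists_addEquiv_subgroupH1_galoisCohomology`** — for `U = res(Γ_L)` (a HYPOTHESIS `hU`, so that `U := κ₂.layerSubgroup n`, `L := κ₂.layer n`
  fit via the tree's `galFixing_layer` + `range_absGaloisRestrict_eq_galFixing`): `Θ : subgroupH1 U M ≃+ galoisCohomology ρL 1`, the pull-back
  along `res : Γ_L ⥲ U` (bijective: `Γ_L` compact, `res` a homeomorphism onto `U`), characterised on cocycles: `Θ [φ] = [φ ∘ res]`.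
* §2 **`exists_localTransport`** — for every `(w, σ, w', hD, hI)` a continuous `θΨ : Γ_{L_{w'}} → U ⊓ D_w`, `g ↦ σ·res(res_{L,w'} g)·σ⁻¹`, and the
  additive `Ψ : subgroupH1 (decompIn U w) M →+ galoisCohomology (GaloisRep.toLocal w' ρL) 1` it induces with coefficients `m ↦ σ⁻¹•m`
  (`Ψ [χ] = [g ↦ σ⁻¹ • χ(θΨ g)]`), with
  (β1) `Ψ (res_{U ⊓ D_w} (conjH1 U M σ z)) = localization ρL (inr w') 1 (Θ z)` for every `Θ` as in §1;
  (β2) `Ψ c ∈ H¹_ur(L_{w'}, M) ↔ resOfLe M (inertiaIn_le_decompIn U w) c = 0`; (β2') `Ψ` injective.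
  The change of coefficients `M₀ → M` and the packaged statement for -w7 g6's (LSₙ) assembler are the sequel `…LayerFieldH1TransportCoeff`.

References: J.-P. Serre, *Galois Cohomology* (1997) I §2.4–§2.5, §5.1; J. Neukirch, A. Schmidt, K. Wingberg (2008) (1.5.2), (1.6.3);
R. Greenberg, LNM 1716 (1999) §2. beyond-print theorem: no (folklore).
-/

set_option linter.dupNamespace false

noncomputable section

open scoped NumberField Pointwise
open CategoryTheory IsDedekindDomain Field NumberField
open Literature.NumberTheory.GaloisRepresentations Literature.NumberTheory.GaloisRepresentations.LocalWeilDatum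
open Literature.NumberTheory.EllipticCurves Literature.NumberTheory.EllipticCurves.GreenbergSelmer
open Summit.BirchSwinnertonDyer.Rank1Residual.X11b
open Summit.BirchSwinnertonDyer.BirchSwinnertonDyer.Theorems.PrintCf2.LocalGroupsBridge

namespace Summit.BirchSwinnertonDyer.BirchSwinnertonDyer.Theorems.PrintCf2.LayerFieldH1

universe u

/-! ## §0. Generic: pull-back of `H¹` along a continuous homomorphism ONTO a group is injective; along an iso, bijective -/

section Generic

variable {G H : Type u} [Group G] [TopologicalSpace G] [IsTopologicalGroup G] [Group H] [TopologicalSpace H] [IsTopologicalGroup H]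
  {X : TopRep.{u} ℤ G} {Y : TopRep.{u} ℤ H}

/-- **Inflation along a surjection is injective on `H¹`**: for a continuous homomorphism `θ : H → G` that is SURJECTIVE and a morphism
`f : res_θ X ⟶ Y` bijective on the modules, `H¹(θ, f)` is injective. [cite: SerreGaloisCohomology1997, I §2.4, §5.1] -/
theorem map_one_injective_of_surjective (θ : H →ₜ* G) (hθ : Function.Surjective θ) (f : TopRep.res (θ : H →* G) X ⟶ Y)
    (hf : Function.Bijective f.hom) : Function.Injective (ContinuousCohomology.map θ f 1).hom := by
  rw [injective_iff_map_eq_zero]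
  intro c hc
  obtain ⟨φ, rfl⟩ := oneCocycleClass_surjective X c
  rw [LocBridge.map_oneCocycleClass_eq_zero_iff X Y θ f hf φ] at hc
  obtain ⟨x, hx⟩ := hc
  rw [oneCocycleClass_eq_zero_iff]
  refine ⟨x, fun g ↦ ?_⟩
  obtain ⟨h, rfl⟩ := hθ g
  exact hx h

/-- **Pull-back along a continuous homomorphism with a continuous two-sided inverse is surjective on `H¹`** (with a module morphism `f` that has a
set-theoretic inverse `f'` which is `θ`-anti-equivariant): every continuous crossed homomorphism `ψ` of `H` is `f ∘ φ ∘ θ` for the continuous crossed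
homomorphism `φ = f' ∘ ψ ∘ θ'` of `G`. [cite: SerreGaloisCohomology1997, I §2.4, §5.1] -/
theorem map_one_surjective_of_inverse (θ : H →ₜ* G) (θ' : C(G, H)) (hθ' : ∀ g, θ (θ' g) = g) (hθ'' : ∀ h, θ' (θ h) = h)
    (f : TopRep.res (θ : H →* G) X ⟶ Y) (f' : Y →L[ℤ] X) (hff' : ∀ y, f.hom (f' y) = y)
    (hf'ρ : ∀ (h : H) (y : Y), f' (Y.ρ h y) = X.ρ (θ h) (f' y)) :
    Function.Surjective (ContinuousCohomology.map θ f 1).hom := by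
  intro c
  obtain ⟨ψ, rfl⟩ := oneCocycleClass_surjective Y c
  -- the pulled-back crossed homomorphism `φ = f' ∘ ψ ∘ θ'` of `G`
  have hmul : ∀ g g' : G, θ' (g * g') = θ' g * θ' g' := fun g g' ↦ by
    obtain ⟨h, rfl⟩ : ∃ h, θ h = g := ⟨θ' g, hθ' g⟩
    obtain ⟨h', rfl⟩ : ∃ h', θ h' = g' := ⟨θ' g', hθ' g'⟩
    rw [← map_mul, hθ'', hθ'', hθ'']
  let φ : contOneCocycles X :=
    ⟨(f' : C(Y, X)).comp (ψ.1.comp θ'), fun g g' ↦ by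
      change f' (ψ.1 (θ' (g * g'))) = f' (ψ.1 (θ' g)) + X.ρ g (f' (ψ.1 (θ' g')))
      rw [hmul, ψ.2, map_add, hf'ρ, hθ']⟩
  refine ⟨oneCocycleClass X φ, ?_⟩
  rw [map_oneCocycleClass]
  congr 1
  apply Subtype.ext
  ext h
  rw [contOneCocycles.pullback_apply]
  change f.hom (f' (ψ.1 (θ' (θ h)))) = ψ.1 h
  rw [hθ'', hff']

end Generic

/-! ## §1. `Θ : H¹(U, M) ≅ H¹(Γ_L, M|_{res})` for `U = res(Γ_L)` -/

section Global

variable {K : Type} [Field K] (L : IntermediateField K (AlgebraicClosure K))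
  (U : Subgroup (absoluteGaloisGroup K)) (hU : (absGaloisRestrict K L).toMonoidHom.range = U)
  (M : Type) [AddCommGroup M] [DistribMulAction (absoluteGaloisGroup K) M] [TopologicalSpace M] [DiscreteTopology M]
  (hM : ∀ m : M, IsOpen {σ : absoluteGaloisGroup K | σ • m = m})

include hU in
/-- `res : Γ_L → Γ_K` lands in `U = res(Γ_L)`. [cite: NeukirchANT1999, Ch. IV §1 (1.1)] -/
theorem absGaloisRestrict_mem (γ : absoluteGaloisGroup L) : absGaloisRestrict K L γ ∈ U := by
  rw [← hU]; exact ⟨γ, rfl⟩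

/-- **`Θ : H¹(U, M) ≃ H¹(Γ_L, M|_{res})`** for `U = res(Γ_L)` (`= galFixing K L` for `L/K` normal, `= κ.layerSubgroup n` for `L = κ.layer n`). There is an
additive bijection from the line's `subgroupH1 U M` to the layer field's `galoisCohomology ((ofSMul M hM).restrictField L) 1` which on cocycles is
`[φ] ↦ [φ ∘ res]` (pull-back along the topological-group isomorphism `res : Γ_L ⥲ U`; injective because `res` is onto `U`, surjective because `res`
has a continuous inverse — `Γ_L` is compact and `Γ_K` Hausdorff). [cite: SerreGaloisCohomology1997, I §2.4, §5.1] [cite: NeukirchSchmidtWingberg2008, (1.5.2)] -/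
theorem exists_addEquiv_subgroupH1_galoisCohomology [NumberField K] :
    ∃ Θ : subgroupH1 U M ≃+ galoisCohomology ((LocBridge.ofSMul M hM).restrictField L) 1,
      ∀ φ : contOneCocycles (discreteTopRep U M),
        ∃ ψ : contOneCocycles ((LocBridge.ofSMul M hM).restrictField L).toTopRep,
          Θ (oneCocycleClass _ φ) = oneCocycleClass _ ψ ∧
            ∀ γ : absoluteGaloisGroup L, ψ.1 γ = φ.1 ⟨absGaloisRestrict K L γ, absGaloisRestrict_mem L U hU γ⟩ := by
  haveI : CharZero L := charZero_of_injective_algebraMap (algebraMap K L).injective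
  set ρL := (LocBridge.ofSMul M hM).restrictField L
  -- `e₁ : Γ_L →ₜ* U`, the range restriction of `res`
  let e₁ : absoluteGaloisGroup L →ₜ* U :=
    { toFun := fun γ ↦ ⟨absGaloisRestrict K L γ, absGaloisRestrict_mem L U hU γ⟩
      map_one' := Subtype.ext (map_one _)
      map_mul' := fun a b ↦ Subtype.ext (map_mul _ a b)
      continuous_toFun := (absGaloisRestrict K L).continuous.subtype_mk _ }
  have he₁ : ∀ γ, ((e₁ γ : U) : absoluteGaloisGroup K) = absGaloisRestrict K L γ := fun _ ↦ rfl
  have hinj : Function.Injective e₁ := fun a b h ↦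
    absGaloisRestrict_injective K L (by rw [← he₁, ← he₁]; exact congrArg Subtype.val h)
  have hsurj : Function.Surjective e₁ := fun u ↦ by
    obtain ⟨γ, hγ⟩ : (u : absoluteGaloisGroup K) ∈ (absGaloisRestrict K L).toMonoidHom.range := by rw [hU]; exact u.2
    exact ⟨γ, Subtype.ext hγ⟩
  -- the continuous inverse (compact → Hausdorff)
  let E : absoluteGaloisGroup L ≃ₜ U := Continuous.homeoOfEquivCompactToT2 (f := Equiv.ofBijective e₁ ⟨hinj, hsurj⟩) e₁.continuous
  have hE : ∀ γ, E γ = e₁ γ := fun _ ↦ rfl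
  -- the module morphism over `e₁`: the identity of `M`
  let f : TopRep.res (e₁ : absoluteGaloisGroup L →* U) (discreteTopRep U M) ⟶ ρL.toTopRep :=
    TopRep.ofHom ⟨ContinuousLinearMap.id ℤ M, fun _ ↦ rfl⟩
  let Θ := (ContinuousCohomology.map e₁ f 1).hom
  have hΘinj : Function.Injective Θ := map_one_injective_of_surjective e₁ hsurj f Function.bijective_id
  have hΘsurj : Function.Surjective Θ :=
    map_one_surjective_of_inverse e₁ ⟨E.symm, E.symm.continuous⟩
      (fun u ↦ by change e₁ (E.symm u) = u; rw [← hE, Homeomorph.apply_symm_apply])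
      (fun γ ↦ by change E.symm (e₁ γ) = γ; rw [← hE, Homeomorph.symm_apply_apply]) f (ContinuousLinearMap.id ℤ M) (fun _ ↦ rfl)
      (fun _ _ ↦ rfl)
  refine ⟨AddEquiv.ofBijective Θ.toLinearMap.toAddMonoidHom ⟨hΘinj, hΘsurj⟩, fun φ ↦ ⟨contOneCocycles.pullback e₁ f φ, ?_, fun γ ↦ rfl⟩⟩
  exact map_oneCocycleClass _ e₁ f φ

end Global

/-! ## §2. The local transport `Ψ` at a place `w' ∣ w` cut out by `σ` -/

section Local

variable {K : Type} [Field K] [NumberField K] (L : IntermediateField K (AlgebraicClosure K)) [NumberField L]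
  (U : Subgroup (absoluteGaloisGroup K)) [U.Normal] (hU : (absGaloisRestrict K L).toMonoidHom.range = U)
  (M : Type) [AddCommGroup M] [DistribMulAction (absoluteGaloisGroup K) M] [TopologicalSpace M] [DiscreteTopology M]
  (hM : ∀ m : M, IsOpen {σ : absoluteGaloisGroup K | σ • m = m})
  (w : HeightOneSpectrum (𝓞 K)) (σ : absoluteGaloisGroup K) (w' : HeightOneSpectrum (𝓞 L))
  (hD : U ⊓ MulAut.conj σ⁻¹ • decomp w = (decomp (K := L) w').map (absGaloisRestrict K L).toMonoidHom)
  (hI : U ⊓ MulAut.conj σ⁻¹ • inertia w = (inertia (K := L) w').map (absGaloisRestrict K L).toMonoidHom)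

omit [U.Normal] in
include hD in
/-- For `g ∈ Γ_{L_{w'}}`: `res (res_{L,w'} g) ∈ U` and `σ · res (res_{L,w'} g) · σ⁻¹ ∈ D_w`. [cite: NeukirchANT1999, Ch. I §9 (9.4)–(9.6)] -/
theorem mem_of_hD (g : absoluteGaloisGroup (w'.adicCompletion L)) :
    absGaloisRestrict K L (absGaloisRestrict L (w'.adicCompletion L) g) ∈ U ∧
      σ * absGaloisRestrict K L (absGaloisRestrict L (w'.adicCompletion L) g) * σ⁻¹ ∈ decomp w := by
  have h : absGaloisRestrict K L (absGaloisRestrict L (w'.adicCompletion L) g) ∈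
      (decomp (K := L) w').map (absGaloisRestrict K L).toMonoidHom := ⟨_, ⟨g, rfl⟩, rfl⟩
  rw [← hD, Subgroup.mem_inf, Subgroup.mem_pointwise_smul_iff_inv_smul_mem, ← map_inv, inv_inv, MulAut.smul_def, MulAut.conj_apply] at h
  exact h

omit [U.Normal] in
include hI in
/-- For `τ ∈ I(L_{w'})`: `σ · res (res_{L,w'} τ) · σ⁻¹ ∈ I_w`. [cite: NeukirchANT1999, Ch. I §9 (9.4)–(9.6)] -/
theorem mem_inertia_of_hI {τ : absoluteGaloisGroup (w'.adicCompletion L)} (hτ : τ ∈ absInertia (w'.adicCompletion L)) :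
    σ * absGaloisRestrict K L (absGaloisRestrict L (w'.adicCompletion L) τ) * σ⁻¹ ∈ inertia w := by
  have h : absGaloisRestrict K L (absGaloisRestrict L (w'.adicCompletion L) τ) ∈
      (inertia (K := L) w').map (absGaloisRestrict K L).toMonoidHom := ⟨_, ⟨τ, hτ, rfl⟩, rfl⟩
  rw [← hI, Subgroup.mem_inf, Subgroup.mem_pointwise_smul_iff_inv_smul_mem, ← map_inv, inv_inv, MulAut.smul_def, MulAut.conj_apply] at h
  exact h.2

include hD in
/-- Every `d ∈ U ⊓ D_w` is `σ · res (res_{L,w'} g) · σ⁻¹` for some `g ∈ Γ_{L_{w'}}`. [cite: NeukirchANT1999, Ch. I §9 (9.4)–(9.6)] -/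
theorem exists_eq_of_mem_decompIn (d : decompIn U w) :
    ∃ g : absoluteGaloisGroup (w'.adicCompletion L),
      σ * absGaloisRestrict K L (absGaloisRestrict L (w'.adicCompletion L) g) * σ⁻¹ = ((d : decomp w) : absoluteGaloisGroup K) := by
  have hd : σ⁻¹ * ((d : decomp w) : absoluteGaloisGroup K) * σ ∈ U ⊓ MulAut.conj σ⁻¹ • decomp w := by
    refine Subgroup.mem_inf.2 ⟨?_, ?_⟩
    · exact Subgroup.Normal.conj_mem' inferInstance _ ((mem_decompIn_iff U w d).1 d.2) σ
    · rw [Subgroup.mem_pointwise_smul_iff_inv_smul_mem, ← map_inv, inv_inv, MulAut.smul_def, MulAut.conj_apply]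
      simpa only [mul_assoc, mul_inv_cancel, mul_one, mul_inv_cancel_left] using (d : decomp w).2
  rw [hD] at hd
  obtain ⟨_, ⟨g, rfl⟩, hg⟩ := hd
  refine ⟨g, ?_⟩
  change absGaloisRestrict K L (absGaloisRestrict L _ g) = _ at hg
  rw [hg]; group

include hI in
/-- Every `l ∈ U ⊓ I_w` is `σ · res (res_{L,w'} τ) · σ⁻¹` for some `τ ∈ I(L_{w'})`. [cite: NeukirchANT1999, Ch. I §9 (9.4)–(9.6)] -/
theorem exists_eq_of_mem_inertiaIn {l : decomp w} (hl : l ∈ inertiaIn U w) :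
    ∃ τ ∈ absInertia (w'.adicCompletion L),
      σ * absGaloisRestrict K L (absGaloisRestrict L (w'.adicCompletion L) τ) * σ⁻¹ = (l : absoluteGaloisGroup K) := by
  rw [mem_inertiaIn_iff] at hl
  have hd : σ⁻¹ * (l : absoluteGaloisGroup K) * σ ∈ U ⊓ MulAut.conj σ⁻¹ • inertia w := by
    refine Subgroup.mem_inf.2 ⟨Subgroup.Normal.conj_mem' inferInstance _ hl.1 σ, ?_⟩
    rw [Subgroup.mem_pointwise_smul_iff_inv_smul_mem, ← map_inv, inv_inv, MulAut.smul_def, MulAut.conj_apply]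
    simpa only [mul_assoc, mul_inv_cancel, mul_one, mul_inv_cancel_left] using hl.2
  rw [hI] at hd
  obtain ⟨_, ⟨τ, hτ, rfl⟩, hg⟩ := hd
  refine ⟨τ, hτ, ?_⟩
  change absGaloisRestrict K L (absGaloisRestrict L _ τ) = _ at hg
  rw [hg]; group

/-- `resH1Hom` on an explicit cocycle class is the class of the pulled-back cocycle (`map_oneCocycleClass`). [cite: SerreGaloisCohomology1997, I §2.4] -/
theorem resH1Hom_oneCocycleClass {G G' : Type} [Group G] [TopologicalSpace G] [IsTopologicalGroup G] [Group G'] [TopologicalSpace G']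
    [IsTopologicalGroup G'] {A B : Type} [AddCommGroup A] [DistribMulAction G A] [TopologicalSpace A] [DiscreteTopology A]
    [AddCommGroup B] [DistribMulAction G' B] [TopologicalSpace B] [DiscreteTopology B]
    (θ : G' →ₜ* G) (ψ : A →+ B) (h : ∀ (x : G') (a : A), ψ (θ x • a) = x • ψ a) (φ : contOneCocycles (discreteTopRep G A)) :
    resH1Hom θ ψ h (oneCocycleClass _ φ) = oneCocycleClass _ (contOneCocycles.pullback θ (resHomOfEquivariant θ ψ h) φ) :=
  map_oneCocycleClass _ θ _ φ

include hD hI hU in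
/-- **THE LOCAL TRANSPORT `Ψ` AT THE PLACE `w'` CUT OUT BY `σ`.** There are a continuous homomorphism
`θΨ : Γ_{L_{w'}} → U ⊓ D_w`, `g ↦ σ · res(res_{L,w'} g) · σ⁻¹`, and the additive map `Ψ : H¹(U ⊓ D_w, M) → H¹(L_{w'}, M|_{res})` it induces
with coefficients `m ↦ σ⁻¹ • m` (`Ψ [χ] = [g ↦ σ⁻¹ • χ(θΨ g)]`), such that: (β1) for every `Θ` as in §1 and every `z ∈ H¹(U, M)`,
`Ψ (res_{U⊓D_w} (conjH1 U M σ z)) = loc_{w'} (Θ z)`; (β2) `Ψ c ∈ H¹_ur(L_{w'}) ↔ res_{U⊓I_w} c = 0`; (β2') `Ψ` is injective.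
[cite: SerreGaloisCohomology1997, I §2.4–§2.5, §5.1] [cite: GreenbergLNM1716, §2] -/
theorem exists_localTransport :
    ∃ (θΨ : absoluteGaloisGroup (w'.adicCompletion L) →ₜ* decompIn U w)
      (Ψ : subgroupH1 (decompIn U w) M →+ galoisCohomology (GaloisRep.toLocal w' ((LocBridge.ofSMul M hM).restrictField L)) 1),
      (∀ g, ((θΨ g : decomp w) : absoluteGaloisGroup K) = σ * absGaloisRestrict K L (absGaloisRestrict L (w'.adicCompletion L) g) * σ⁻¹) ∧
      (∀ χ : contOneCocycles (discreteTopRep (decompIn U w) M),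
        ∃ χ' : contOneCocycles (GaloisRep.toLocal w' ((LocBridge.ofSMul M hM).restrictField L)).toTopRep,
          Ψ (oneCocycleClass _ χ) = oneCocycleClass _ χ' ∧ ∀ g, χ'.1 g = σ⁻¹ • χ.1 (θΨ g)) ∧
      (∀ (Θ : subgroupH1 U M ≃+ galoisCohomology ((LocBridge.ofSMul M hM).restrictField L) 1)
        (_ : ∀ φ : contOneCocycles (discreteTopRep U M), ∃ ψ : contOneCocycles ((LocBridge.ofSMul M hM).restrictField L).toTopRep,
          Θ (oneCocycleClass _ φ) = oneCocycleClass _ ψ ∧ ∀ γ, ψ.1 γ = φ.1 ⟨absGaloisRestrict K L γ, absGaloisRestrict_mem L U hU γ⟩)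
        (z : subgroupH1 U M),
        Ψ (resH1Hom (decompInToH U w) (AddMonoidHom.id M) (fun _ _ ↦ rfl) (conjH1 U M σ z)) =
          galoisCohomology.localization ((LocBridge.ofSMul M hM).restrictField L) (Sum.inr w') 1 (Θ z)) ∧
      (∀ c : subgroupH1 (decompIn U w) M,
        Ψ c ∈ DiscreteGaloisModule.unramifiedSubgroup (GaloisRep.toLocal w' ((LocBridge.ofSMul M hM).restrictField L)) 1 ↔
          resOfLe M (inertiaIn_le_decompIn U w) c = 0) ∧
      Function.Injective Ψ := by
  set ρL := (LocBridge.ofSMul M hM).restrictField L with hρL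
  have hmem := fun g ↦ mem_of_hD L U w σ w' hD g
  -- `θΨ : Γ_{L_{w'}} → U ⊓ D_w`, `g ↦ σ · res(res_{L,w'} g) · σ⁻¹`
  let θΨ : absoluteGaloisGroup (w'.adicCompletion L) →ₜ* decompIn U w :=
    { toFun := fun g ↦ ⟨⟨σ * absGaloisRestrict K L (absGaloisRestrict L (w'.adicCompletion L) g) * σ⁻¹, (hmem g).2⟩,
        (mem_decompIn_iff U w _).2 (Subgroup.Normal.conj_mem inferInstance _ (hmem g).1 σ)⟩
      map_one' := Subtype.ext (Subtype.ext (by simp))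
      map_mul' := fun a b ↦ Subtype.ext (Subtype.ext (by
        change σ * absGaloisRestrict K L (absGaloisRestrict L _ (a * b)) * σ⁻¹ =
          σ * absGaloisRestrict K L (absGaloisRestrict L _ a) * σ⁻¹ * (σ * absGaloisRestrict K L (absGaloisRestrict L _ b) * σ⁻¹)
        rw [map_mul, map_mul]; group))
      continuous_toFun := by
        refine Continuous.subtype_mk (Continuous.subtype_mk ?_ _) _
        exact (continuous_const.mul ((absGaloisRestrict K L).continuous.comp (absGaloisRestrict L _).continuous)).mul
          continuous_const }
  have hθΨ : ∀ g, ((θΨ g : decomp w) : absoluteGaloisGroup K) =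
      σ * absGaloisRestrict K L (absGaloisRestrict L (w'.adicCompletion L) g) * σ⁻¹ := fun _ ↦ rfl
  -- the module morphism over `θΨ`: `m ↦ σ⁻¹ • m`
  let fΨ : TopRep.res (θΨ : absoluteGaloisGroup (w'.adicCompletion L) →* decompIn U w) (discreteTopRep (decompIn U w) M) ⟶
      (GaloisRep.toLocal w' ρL).toTopRep :=
    TopRep.ofHom
      { toLinearMap := (DistribSMul.toAddMonoidHom M σ⁻¹).toIntLinearMap
        cont := continuous_of_discreteTopology
        isIntertwining' := fun g ↦ by
          ext m
          change σ⁻¹ • (((θΨ g : decomp w) : absoluteGaloisGroup K) • m) =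
            absGaloisRestrict K L (absGaloisRestrict L (w'.adicCompletion L) g) • (σ⁻¹ • m)
          rw [hθΨ, smul_smul, smul_smul]
          congr 1
          group }
  have hfΨ : ∀ m, fΨ.hom m = σ⁻¹ • m := fun _ ↦ rfl
  have hfΨbij : Function.Bijective fΨ.hom := by
    change Function.Bijective (fun m : M ↦ σ⁻¹ • m)
    exact MulAction.bijective σ⁻¹
  let Ψ : subgroupH1 (decompIn U w) M →+ galoisCohomology (GaloisRep.toLocal w' ρL) 1 :=
    (ContinuousCohomology.map θΨ fΨ 1).hom.toLinearMap.toAddMonoidHom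
  have hΨ : ∀ χ, Ψ (oneCocycleClass _ χ) = oneCocycleClass _ (contOneCocycles.pullback θΨ fΨ χ) :=
    fun χ ↦ map_oneCocycleClass _ θΨ fΨ χ
  -- localisation on cocycles
  have hloc : ∀ ψ : contOneCocycles ρL.toTopRep,
      galoisCohomology.localization ρL (Sum.inr w') 1 (oneCocycleClass _ ψ) =
        oneCocycleClass (GaloisRep.toLocal w' ρL).toTopRep
          (contOneCocycles.pullback (absGaloisRestrict L (w'.adicCompletion L))
            (TopRep.ofHom ⟨ContinuousLinearMap.id ℤ M, fun _ ↦ rfl⟩) ψ) :=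
    fun ψ ↦ map_oneCocycleClass _ _ _ ψ
  refine ⟨θΨ, Ψ, hθΨ, fun χ ↦ ⟨_, hΨ χ, fun g ↦ rfl⟩, fun Θ hΘ z ↦ ?_, fun c ↦ ?_, ?_⟩
  · -- (β1)
    obtain ⟨φ, rfl⟩ := oneCocycleClass_surjective _ z
    obtain ⟨ψ, hΘφ, hψ⟩ := hΘ φ
    rw [hΘφ, hloc, conjH1, resH1Hom_oneCocycleClass, resH1Hom_oneCocycleClass, hΨ]
    congr 1
    apply Subtype.ext
    ext g
    change fΨ.hom ((AddMonoidHom.id M) (σ • φ.1 (subgroupConj U σ (decompInToH U w (θΨ g))))) = ψ.1 (absGaloisRestrict L _ g)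
    rw [hfΨ, hψ, AddMonoidHom.id_apply, inv_smul_smul]
    congr 1
    apply Subtype.ext
    change σ⁻¹ * (σ * absGaloisRestrict K L (absGaloisRestrict L _ g) * σ⁻¹) * σ = absGaloisRestrict K L (absGaloisRestrict L _ g)
    group
  · -- (β2)
    obtain ⟨χ, rfl⟩ := oneCocycleClass_surjective _ c
    rw [hΨ]
    refine (DiscreteGaloisModule.oneCocycleClass_mem_unramifiedSubgroup_iff_exists (GaloisRep.toLocal w' ρL) _).trans ?_
    rw [resOfLe, LocBridge.resH1Hom_oneCocycleClass_eq_zero_iff _ _ _ Function.bijective_id]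
    constructor
    · rintro ⟨v, hv⟩
      refine ⟨σ • v, fun l ↦ ?_⟩
      obtain ⟨τ, hτ, hτl⟩ := exists_eq_of_mem_inertiaIn L U w σ w' hI l.2
      have h1 := hv τ hτ
      rw [contOneCocycles.pullback_apply, hfΨ] at h1
      change σ⁻¹ • χ.1 (θΨ τ) = absGaloisRestrict K L (absGaloisRestrict L _ τ) • v - v at h1
      have h2 : θΨ τ = subgroupInclusion (inertiaIn_le_decompIn U w) l :=
        Subtype.ext (Subtype.ext (by rw [hθΨ, hτl]; rfl))
      rw [← h2]
      change χ.1 (θΨ τ) = ((θΨ τ : decomp w) : absoluteGaloisGroup K) • (σ • v) - σ • v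
      rw [hθΨ, ← smul_smul, ← smul_smul, inv_smul_smul, ← smul_sub, ← h1, smul_inv_smul]
    · rintro ⟨x, hx⟩
      refine ⟨σ⁻¹ • x, fun τ hτ ↦ ?_⟩
      have hτI : (θΨ τ : decomp w) ∈ inertiaIn U w :=
        (mem_inertiaIn_iff U w _).2 ⟨(mem_decompIn_iff U w _).1 (θΨ τ).2, hθΨ τ ▸ mem_inertia_of_hI L U w σ w' hI hτ⟩
      have h1 := hx ⟨θΨ τ, hτI⟩
      rw [contOneCocycles.pullback_apply, hfΨ]
      change σ⁻¹ • χ.1 (θΨ τ) = absGaloisRestrict K L (absGaloisRestrict L _ τ) • (σ⁻¹ • x) - σ⁻¹ • x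
      have h2 : subgroupInclusion (inertiaIn_le_decompIn U w) ⟨θΨ τ, hτI⟩ = θΨ τ := rfl
      rw [h2] at h1
      change χ.1 (θΨ τ) = ((θΨ τ : decomp w) : absoluteGaloisGroup K) • x - x at h1
      rw [h1, hθΨ, smul_sub, smul_smul, smul_smul]
      congr 2
      group
  · -- (β2') injectivity
    refine map_one_injective_of_surjective θΨ (fun d ↦ ?_) fΨ hfΨbij
    obtain ⟨g, hg⟩ := exists_eq_of_mem_decompIn L U w σ w' hD d
    exact ⟨g, Subtype.ext (Subtype.ext (by rw [hθΨ, hg]))⟩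

end Local

end Summit.BirchSwinnertonDyer.BirchSwinnertonDyer.Theorems.PrintCf2.LayerFieldH1
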